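import Summits.BirchSwinnertonDyer.BirchSwinnertonDyer.Theorems.PrintX11aUpperNonSurjFiveOfCornerTwinMuAn
import Summits.BirchSwinnertonDyer.BirchSwinnertonDyer.Theorems.PrintX11aUpperNonSurjThreeOfNineFacts
import HarnessLib

/-!
# Route `PrintX11a`, child crux U5 = `PrintX11a.UpperNonSurjFive` (item stmt-BirchSwinnertonDyer-20614): **U5 and its parent BY NAME
# from the rung (resp. item 19948 + BDMTV) and the nine print-exact facts WITH GREENBERG–STEVENS KEYED AT ODD PRIMES** — the input
# text shared literally with U3's registered line finemu3 r6 (cell `bsd-print-x11a`, LEAD `bsd-line-x11a-p3` g7 of line «finemu5» r7;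
# `--supports stmt-BirchSwinnertonDyer-20614`)

HONEST FRAMING.  BSD is not proved by any of this; nothing is asserted about any curve.  Theorems only: no definition, no named fact
minted, no `sorry`; every theorem is CONDITIONAL on its displayed hypotheses and closes nothing by itself (the gate records a
`conditional-result`; item 20614's own signature is not proved).

WHY THIS FILE.  g6's road for U5 (`upperNonSurjFive_of_muAnHardFive_of_nineFacts`, p626443; `…_of_nonSurjCornerTwinMuAn_of_nineFacts`,
p627441) reads the exceptional-zero formula as `∀ W p, greenberg_stevens (W := W) (p := p)` — the shape of conjunct 14 of item 19949 —
i.e. INCLUDING the instance `p = 2`, for which the docstring of `Literature.NumberTheory.EllipticCurves.greenberg_stevens` records that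
no printed proof has been located (Greenberg–Stevens 1993: `p ≥ 5`; Kobayashi 2006 Cor. 4.2: odd `p`).  Width seat x11a-p2 g4 fixed the
print scope for U3 (`upperNonSurjThree_of_nineFacts_oddGS[_glue]`, append p625569) and LEAD x11a-p1 g1 registered finemu3 r6 with the
ONE stub `stub_nineFactsOddGS` (GS slot `∀ W p, p ≠ 2 → greenberg_stevens`).  U5 reads the formula only at a SPLIT multiplicative `p ≥ 5`
(the per-pair theorem `ClassX11a.missingUpperBoundAt_of_not_surj_of_hardCert_of_nineFacts` takes
`hGS : W.HasSplitMultiplicativeReductionAtPrime p → greenberg_stevens (W := W) (p := p)` at the pair, and an X11a pair has `p ≠ 2`),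
so the same re-keying costs U5 nothing.  After this file U3 (20613), U5 (20614) and their parent `X11aNonSurjEulerHalf` (20406) are
glued from ONE AND THE SAME nine-conjunct print-exact text — the statement of `Cruxes.UpperNonSurjThree.FineMu.stub_nineFactsOddGS`
(finemu3 r6) = `Cruxes.UpperNonSurjFive.FineMu.stub_nineFactsOddGS` (finemu5 r7) — plus, for U5 ∕ the parent, ONE open statement
(the rung `Theorems.X11aNonSurjMuAnHardFive` ⟺ item 19948 `Theorems.NonSurjCornerTwinMuAn` mod BDMTV, x11a-p1 g1 p625247).

WHAT.
* §1 `upperNonSurjFive_of_muAnHardFive_of_nineFactsOddGS : X11aNonSurjMuAnHardFive → hJs → hJn → hGSodd → … → hMz → UpperNonSurjFive`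
  and its `_glue` shape `(rung ∧ nine-fact conjunction, odd GS) → UpperNonSurjFive` (planner option (a): child = the rung verbatim,
  input item = the odd-keyed nine conjuncts shared with U3).
* §2 `upperNonSurjFive_of_nonSurjCornerTwinMuAn_of_nineFactsOddGS : hB → NonSurjCornerTwinMuAn → ⟨nine facts, odd GS⟩ → UpperNonSurjFive`
  and its `_glue` shape `(item 19948 ∧ BDMTV ∧ nine-fact conjunction, odd GS) → UpperNonSurjFive` (planner option (b): ATTACH 20614 to
  item 19948 — director-bsd 2026-08-28T11:17:57Z (b)).
* §3 the parent `x11aNonSurjEulerHalf_of_muAnHardFive_of_nineFactsOddGS` ∕ `…_of_nonSurjCornerTwinMuAn_of_nineFactsOddGS` (item 20406 BY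
  NAME; the `p = 3` part is U3's μ₃ THEOREM inside `ClassX11a.missingUpperBoundAt_three_of_not_surj_of_nineFacts`, GS read at a split `3`).
* §4 projections: the all-prime texts of p626443 ∕ p627441 imply the odd-keyed ones (`Theorems.nineFactsOddGS_of_nineFactsAn`, x11a-p2 g4),
  so g6's registered r6 stub `stub_nineFactsAn` still closes U5 through the odd-keyed glue — the kernel record that the re-keying is a
  pure WEAKENING of the input.

beyond-print theorem: NO (re-plumbing of landed theorems; the only beyond-print input is the rung ∕ item 19948, displayed as a hypothesis).

References: [Kobayashi2006DocMath] Cor. 4.2 (p. 575); [GreenbergStevens1993] (p ≥ 5); [SteinWuthrich2013] Thm. 6.1 (p. 20); [Kato2004Asterisque]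
Thm. 12.4 (p. 221), §17.13 (pp. 279–280); [Mazur1978] Cor. 4.1; [BalakrishnanEtAl2019] §1 Thm. 1.2; [GreenbergLNM1716] §1 Conj. 1.11 (p. 62);
tree `Theorems/PrintX11aUpperNonSurjFiveOfNineFacts.lean` (p626443), `Theorems/PrintX11aUpperNonSurjFiveOfCornerTwinMuAn.lean` (p627441),
`Theorems/PrintX11aUpperNonSurjThreeOfNineFacts.lean` (p624348 + p625569), `Theorems/PrintX11aNonSurjMuAnHardFiveIffTwinMuAn.lean` (p625247).
-/

set_option linter.dupNamespace false
set_option autoImplicit false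

noncomputable section

open scoped Classical MatrixGroups ModularForm

open CongruenceSubgroup WeierstrassCurve
  Literature.NumberTheory.EllipticCurves
  Literature.NumberTheory.EllipticCurves.ModularForms
  Literature.NumberTheory.EllipticCurves.Rank1Residual
  Literature.NumberTheory.EllipticCurves.Rank1Residual.Typed
  Literature.NumberTheory.EllipticCurves.SteinWuthrich2013
  Literature.NumberTheory.EllipticCurves.Kato2004
  Literature.NumberTheory.EllipticCurves.BalakrishnanEtAl2019
  Summit.BirchSwinnertonDyer.Rank1Residual
  Summit.BirchSwinnertonDyer.BirchSwinnertonDyer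

namespace Summit.BirchSwinnertonDyer.BirchSwinnertonDyer.Theorems

/-! ### §1 U5 BY NAME from the rung and the nine facts, Greenberg–Stevens at ODD primes -/

/-- **Crux U5 `PrintX11a.UpperNonSurjFive` from its registered rung and NINE print-exact named facts, the exceptional-zero formula
keyed at ODD primes only** (sorry-free, CONDITIONAL; closes nothing by itself): as `upperNonSurjFive_of_muAnHardFive_of_nineFacts`
(p626443) but with `hGS : ∀ W p, p ≠ 2 → greenberg_stevens` — Kobayashi 2006 Cor. 4.2 as printed, without the unprinted `p = 2`
instance.  U5 reads GS only at the split multiplicative prime `p ≥ 5` of the pair (`p ≠ 2` from `ClassX11a.ne_two`).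
[cite: Kobayashi2006DocMath, Cor. 4.2 (p. 575)] [cite: GreenbergLNM1716, §1 Conj. 1.11 (p. 62)] [cite: SteinWuthrich2013, Thm. 6.1 (p. 20)]
[cite: Kato2004Asterisque, Thm. 12.4 (p. 221) and §17.13 (pp. 279–280)] [cite: Mazur1978, Cor. 4.1] -/
theorem upperNonSurjFive_of_muAnHardFive_of_nineFactsOddGS (hH : X11aNonSurjMuAnHardFive)
    (hJs : thm61_splitMultiplicative) (hJn : thm61_nonsplitMultiplicative)
    (hGS : ∀ (W : WeierstrassCurve ℚ) [W.IsElliptic] [W.IsGloballyMinimal] (p : ℕ) [Fact p.Prime],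
      p ≠ 2 → greenberg_stevens (W := W) (p := p))
    (h12 : Kato2004.thm12_4) (hnf : exists_isNewformOf)
    (hns' : Kato2004.exists_multDivisibilityInputs_nonsplit_contra)
    (hsp' : Kato2004.exists_multDivisibilityInputs_split_contra)
    (hfine' : Kato2004.exists_multDivisibilityInputs_fine_contra) (hMz : mazur_not_dvd_maninConstant_of_odd) :
    Theses.PrintX11a.UpperNonSurjFive := by
  intro W _ _ p _ hX hns hp5
  exact Rank1Residual.ClassX11a.missingUpperBoundAt_of_not_surj_of_hardCert_of_nineFacts hJs hJn h12 hnf hns' hsp'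
    hfine' hMz W p (fun _ => hGS W p hX.ne_two) hX hns (fun hhard _ _ f hf ϖ hϖ a L hsa hna hL =>
      hH W p hX hns hp5 hhard f hf ϖ hϖ a L hsa hna hL)

/-- **Glue shape, option (a), GS at odd primes**: (rung ∧ the nine-fact conjunction with its third conjunct read
`∀ W p, p ≠ 2 → greenberg_stevens`) → `UpperNonSurjFive` — child = the rung `Theorems.X11aNonSurjMuAnHardFive` verbatim, input item = the
odd-keyed nine conjuncts = the statement of finemu3 r6's `stub_nineFactsOddGS` (shared with U3, glue there
`upperNonSurjThree_of_nineFacts_oddGS_glue`). [cite: Kobayashi2006DocMath, Cor. 4.2 (p. 575)] [cite: GreenbergLNM1716, §1 Conj. 1.11 (p. 62)] -/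
theorem upperNonSurjFive_of_muAnHardFive_of_nineFactsOddGS_glue :
    (X11aNonSurjMuAnHardFive ∧ thm61_splitMultiplicative ∧ thm61_nonsplitMultiplicative ∧
      (∀ (W : WeierstrassCurve ℚ) [W.IsElliptic] [W.IsGloballyMinimal] (p : ℕ) [Fact p.Prime],
        p ≠ 2 → greenberg_stevens (W := W) (p := p)) ∧
      Kato2004.thm12_4 ∧ exists_isNewformOf ∧ Kato2004.exists_multDivisibilityInputs_nonsplit_contra ∧
      Kato2004.exists_multDivisibilityInputs_split_contra ∧ Kato2004.exists_multDivisibilityInputs_fine_contra ∧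
      mazur_not_dvd_maninConstant_of_odd) →
    Theses.PrintX11a.UpperNonSurjFive :=
  fun ⟨hH, hJs, hJn, hGS, h12, hnf, hns', hsp', hfine', hMz⟩ ↦
    upperNonSurjFive_of_muAnHardFive_of_nineFactsOddGS hH hJs hJn hGS h12 hnf hns' hsp' hfine' hMz

/-- **Glue shape, option (a′), two items**: rung → (odd-keyed nine-fact conjunction) → `UpperNonSurjFive` — the curried form a planner
uses when the rung and the shared input item are filed as TWO children. [cite: Kobayashi2006DocMath, Cor. 4.2 (p. 575)]
[cite: GreenbergLNM1716, §1 Conj. 1.11 (p. 62)] -/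
theorem upperNonSurjFive_of_muAnHardFive_of_nineFactsOddGS_glue₂ (hH : X11aNonSurjMuAnHardFive)
    (hI : thm61_splitMultiplicative ∧ thm61_nonsplitMultiplicative ∧
      (∀ (W : WeierstrassCurve ℚ) [W.IsElliptic] [W.IsGloballyMinimal] (p : ℕ) [Fact p.Prime],
        p ≠ 2 → greenberg_stevens (W := W) (p := p)) ∧
      Kato2004.thm12_4 ∧ exists_isNewformOf ∧ Kato2004.exists_multDivisibilityInputs_nonsplit_contra ∧
      Kato2004.exists_multDivisibilityInputs_split_contra ∧ Kato2004.exists_multDivisibilityInputs_fine_contra ∧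
      mazur_not_dvd_maninConstant_of_odd) :
    Theses.PrintX11a.UpperNonSurjFive :=
  let ⟨hJs, hJn, hGS, h12, hnf, hns', hsp', hfine', hMz⟩ := hI
  upperNonSurjFive_of_muAnHardFive_of_nineFactsOddGS hH hJs hJn hGS h12 hnf hns' hsp' hfine' hMz

/-! ### §2 U5 BY NAME from item 19948, BDMTV and the nine facts, Greenberg–Stevens at ODD primes -/

/-- **Crux U5 BY NAME from item 19948, BDMTV and the nine print-exact facts with GS at odd primes** (sorry-free, CONDITIONAL; closes
nothing by itself): x11a-p1 g1's `x11aNonSurjMuAnHardFive_of_nonSurjCornerTwinMuAn` (p625247: item 19948 ⟹ the rung, mod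
Balakrishnan–Dogra–Müller–Tuitman–Vonk Thm. 1.2 `hB`) composed with §1.
[cite: BalakrishnanEtAl2019, §1 Thm. 1.2 (arXiv:1711.05846 p. 2)] [cite: Kobayashi2006DocMath, Cor. 4.2 (p. 575)]
[cite: Kato2004Asterisque, Thm. 12.4 (p. 221) and §17.13 (pp. 279–280)] [cite: SteinWuthrich2013, Thm. 6.1 (p. 20)] [cite: Mazur1978, Cor. 4.1] -/
theorem upperNonSurjFive_of_nonSurjCornerTwinMuAn_of_nineFactsOddGS (hB : thm12_not_le_normalizer_splitCartan)
    (hAn : NonSurjCornerTwinMuAn)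
    (hJs : thm61_splitMultiplicative) (hJn : thm61_nonsplitMultiplicative)
    (hGS : ∀ (W : WeierstrassCurve ℚ) [W.IsElliptic] [W.IsGloballyMinimal] (p : ℕ) [Fact p.Prime],
      p ≠ 2 → greenberg_stevens (W := W) (p := p))
    (h12 : Kato2004.thm12_4) (hnf : exists_isNewformOf)
    (hns' : Kato2004.exists_multDivisibilityInputs_nonsplit_contra)
    (hsp' : Kato2004.exists_multDivisibilityInputs_split_contra)
    (hfine' : Kato2004.exists_multDivisibilityInputs_fine_contra) (hMz : mazur_not_dvd_maninConstant_of_odd) :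
    Theses.PrintX11a.UpperNonSurjFive :=
  upperNonSurjFive_of_muAnHardFive_of_nineFactsOddGS (x11aNonSurjMuAnHardFive_of_nonSurjCornerTwinMuAn hB hAn) hJs hJn hGS
    h12 hnf hns' hsp' hfine' hMz

/-- **Glue shape, option (b) ATTACH, GS at odd primes**: (item 19948 ∧ BDMTV ∧ the odd-keyed nine-fact conjunction) → `UpperNonSurjFive`.
[cite: BalakrishnanEtAl2019, §1 Thm. 1.2 (arXiv:1711.05846 p. 2)] [cite: Kobayashi2006DocMath, Cor. 4.2 (p. 575)]
[cite: GreenbergLNM1716, §1 Conj. 1.11 (p. 62)] -/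
theorem upperNonSurjFive_of_nonSurjCornerTwinMuAn_of_nineFactsOddGS_glue :
    (NonSurjCornerTwinMuAn ∧ thm12_not_le_normalizer_splitCartan ∧
      thm61_splitMultiplicative ∧ thm61_nonsplitMultiplicative ∧
      (∀ (W : WeierstrassCurve ℚ) [W.IsElliptic] [W.IsGloballyMinimal] (p : ℕ) [Fact p.Prime],
        p ≠ 2 → greenberg_stevens (W := W) (p := p)) ∧
      Kato2004.thm12_4 ∧ exists_isNewformOf ∧ Kato2004.exists_multDivisibilityInputs_nonsplit_contra ∧
      Kato2004.exists_multDivisibilityInputs_split_contra ∧ Kato2004.exists_multDivisibilityInputs_fine_contra ∧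
      mazur_not_dvd_maninConstant_of_odd) →
    Theses.PrintX11a.UpperNonSurjFive :=
  fun ⟨hAn, hB, hJs, hJn, hGS, h12, hnf, hns', hsp', hfine', hMz⟩ ↦
    upperNonSurjFive_of_nonSurjCornerTwinMuAn_of_nineFactsOddGS hB hAn hJs hJn hGS h12 hnf hns' hsp' hfine' hMz

/-- **Glue shape, option (b′), three items**: item 19948 → BDMTV (route `ErratumRoadFive` aside item `SplitCartanImagesBDMTV`, i.e. the
named fact `thm12_not_le_normalizer_splitCartan`) → (odd-keyed nine-fact conjunction, the input item shared with U3) → `UpperNonSurjFive`.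
[cite: BalakrishnanEtAl2019, §1 Thm. 1.2 (arXiv:1711.05846 p. 2)] [cite: Kobayashi2006DocMath, Cor. 4.2 (p. 575)] -/
theorem upperNonSurjFive_of_nonSurjCornerTwinMuAn_of_nineFactsOddGS_glue₃ (hAn : NonSurjCornerTwinMuAn)
    (hB : thm12_not_le_normalizer_splitCartan)
    (hI : thm61_splitMultiplicative ∧ thm61_nonsplitMultiplicative ∧
      (∀ (W : WeierstrassCurve ℚ) [W.IsElliptic] [W.IsGloballyMinimal] (p : ℕ) [Fact p.Prime],
        p ≠ 2 → greenberg_stevens (W := W) (p := p)) ∧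
      Kato2004.thm12_4 ∧ exists_isNewformOf ∧ Kato2004.exists_multDivisibilityInputs_nonsplit_contra ∧
      Kato2004.exists_multDivisibilityInputs_split_contra ∧ Kato2004.exists_multDivisibilityInputs_fine_contra ∧
      mazur_not_dvd_maninConstant_of_odd) :
    Theses.PrintX11a.UpperNonSurjFive :=
  let ⟨hJs, hJn, hGS, h12, hnf, hns', hsp', hfine', hMz⟩ := hI
  upperNonSurjFive_of_nonSurjCornerTwinMuAn_of_nineFactsOddGS hB hAn hJs hJn hGS h12 hnf hns' hsp' hfine' hMz

/-! ### §3 The parent crux `X11aNonSurjEulerHalf` (item 20406) BY NAME, Greenberg–Stevens at ODD primes -/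

/-- **The whole Euler-system half at non-surjective image from ONE open statement and the nine print-exact facts with GS at odd
primes** (sorry-free, CONDITIONAL; closes nothing by itself): `Theses.PrintX11a.X11aNonSurjEulerHalf` from the rung
`Theorems.X11aNonSurjMuAnHardFive` and the odd-keyed nine facts — the `p = 3` part is U3's body
`ClassX11a.missingUpperBoundAt_three_of_not_surj_of_nineFacts` (μ₃ a THEOREM mod Mazur) with GS read at a split `3`
(`Theorems.gsAtThree_of_oddGS`), the `p ≥ 5` part is §1; an X11a pair has `p ≠ 2`, so `p = 3 ∨ 5 ≤ p`.
[cite: Kobayashi2006DocMath, Cor. 4.2 (p. 575)] [cite: GreenbergLNM1716, §1 Conj. 1.11 (p. 62)]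
[cite: Kato2004Asterisque, Thm. 12.4 (p. 221) and §17.13 (pp. 279–280)] [cite: SteinWuthrich2013, Thm. 6.1 (p. 20)] [cite: Mazur1978, Cor. 4.1] -/
theorem x11aNonSurjEulerHalf_of_muAnHardFive_of_nineFactsOddGS (hH : X11aNonSurjMuAnHardFive)
    (hJs : thm61_splitMultiplicative) (hJn : thm61_nonsplitMultiplicative)
    (hGS : ∀ (W : WeierstrassCurve ℚ) [W.IsElliptic] [W.IsGloballyMinimal] (p : ℕ) [Fact p.Prime],
      p ≠ 2 → greenberg_stevens (W := W) (p := p))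
    (h12 : Kato2004.thm12_4) (hnf : exists_isNewformOf)
    (hns' : Kato2004.exists_multDivisibilityInputs_nonsplit_contra)
    (hsp' : Kato2004.exists_multDivisibilityInputs_split_contra)
    (hfine' : Kato2004.exists_multDivisibilityInputs_fine_contra) (hMz : mazur_not_dvd_maninConstant_of_odd) :
    Theses.PrintX11a.X11aNonSurjEulerHalf := by
  intro W _ _ p _ hX hns
  by_cases h3 : p = 3
  · exact upperNonSurjThree_of_nineFacts_oddGS hJs hJn hGS h12 hnf hns' hsp' hfine' hMz W p hX hns h3
  · -- an X11a pair has `p ≠ 2`; a prime other than `2, 3` is `≥ 5`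
    have hpP : p.Prime := Fact.out
    have h2 : p ≠ 2 := hX.ne_two
    have h2le := hpP.two_le
    have h4 : p ≠ 4 := fun h => by rw [h] at hpP; exact absurd hpP (by decide)
    exact upperNonSurjFive_of_muAnHardFive_of_nineFactsOddGS hH hJs hJn hGS h12 hnf hns' hsp' hfine' hMz W p hX hns (by omega)

/-- **The parent crux BY NAME from item 19948, BDMTV and the odd-keyed nine facts** (sorry-free, CONDITIONAL; closes nothing).
[cite: BalakrishnanEtAl2019, §1 Thm. 1.2 (arXiv:1711.05846 p. 2)] [cite: Kobayashi2006DocMath, Cor. 4.2 (p. 575)]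
[cite: GreenbergLNM1716, §1 Conj. 1.11 (p. 62)] -/
theorem x11aNonSurjEulerHalf_of_nonSurjCornerTwinMuAn_of_nineFactsOddGS (hB : thm12_not_le_normalizer_splitCartan)
    (hAn : NonSurjCornerTwinMuAn)
    (hJs : thm61_splitMultiplicative) (hJn : thm61_nonsplitMultiplicative)
    (hGS : ∀ (W : WeierstrassCurve ℚ) [W.IsElliptic] [W.IsGloballyMinimal] (p : ℕ) [Fact p.Prime],
      p ≠ 2 → greenberg_stevens (W := W) (p := p))
    (h12 : Kato2004.thm12_4) (hnf : exists_isNewformOf)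
    (hns' : Kato2004.exists_multDivisibilityInputs_nonsplit_contra)
    (hsp' : Kato2004.exists_multDivisibilityInputs_split_contra)
    (hfine' : Kato2004.exists_multDivisibilityInputs_fine_contra) (hMz : mazur_not_dvd_maninConstant_of_odd) :
    Theses.PrintX11a.X11aNonSurjEulerHalf :=
  x11aNonSurjEulerHalf_of_muAnHardFive_of_nineFactsOddGS (x11aNonSurjMuAnHardFive_of_nonSurjCornerTwinMuAn hB hAn) hJs hJn
    hGS h12 hnf hns' hsp' hfine' hMz

/-- **Glue shape for the parent, option (a)**: (rung ∧ odd-keyed nine-fact conjunction) → `X11aNonSurjEulerHalf` — ONE open statement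
and nine print-exact facts give the whole Euler-system half of route `PrintX11a` at non-surjective image.
[cite: Kobayashi2006DocMath, Cor. 4.2 (p. 575)] [cite: GreenbergLNM1716, §1 Conj. 1.11 (p. 62)] -/
theorem x11aNonSurjEulerHalf_of_muAnHardFive_of_nineFactsOddGS_glue :
    (X11aNonSurjMuAnHardFive ∧ thm61_splitMultiplicative ∧ thm61_nonsplitMultiplicative ∧
      (∀ (W : WeierstrassCurve ℚ) [W.IsElliptic] [W.IsGloballyMinimal] (p : ℕ) [Fact p.Prime],
        p ≠ 2 → greenberg_stevens (W := W) (p := p)) ∧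
      Kato2004.thm12_4 ∧ exists_isNewformOf ∧ Kato2004.exists_multDivisibilityInputs_nonsplit_contra ∧
      Kato2004.exists_multDivisibilityInputs_split_contra ∧ Kato2004.exists_multDivisibilityInputs_fine_contra ∧
      mazur_not_dvd_maninConstant_of_odd) →
    Theses.PrintX11a.X11aNonSurjEulerHalf :=
  fun ⟨hH, hJs, hJn, hGS, h12, hnf, hns', hsp', hfine', hMz⟩ ↦
    x11aNonSurjEulerHalf_of_muAnHardFive_of_nineFactsOddGS hH hJs hJn hGS h12 hnf hns' hsp' hfine' hMz

/-! ### §4 Projections: g6's all-prime texts imply the odd-keyed ones (the re-keying is a pure weakening of the input) -/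

/-- **U5 from g6's registered r6 stub text, routed through the odd-keyed glue**: the all-prime conjunction (`stub_nineFactsAn`'s
statement, p626443's glue hypothesis) implies `UpperNonSurjFive` VIA `Theorems.nineFactsOddGS_of_nineFactsAn` and §1 — the kernel
record that re-keying GS at odd primes costs U5's composition nothing. [cite: Kobayashi2006DocMath, Cor. 4.2 (p. 575)]
[cite: GreenbergLNM1716, §1 Conj. 1.11 (p. 62)] -/
theorem upperNonSurjFive_of_muAnHardFive_of_nineFactsAn_via_oddGS (hH : X11aNonSurjMuAnHardFive)
    (hI : thm61_splitMultiplicative ∧ thm61_nonsplitMultiplicative ∧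
      (∀ (W : WeierstrassCurve ℚ) [W.IsElliptic] [W.IsGloballyMinimal] (p : ℕ) [Fact p.Prime],
        greenberg_stevens (W := W) (p := p)) ∧
      Kato2004.thm12_4 ∧ exists_isNewformOf ∧ Kato2004.exists_multDivisibilityInputs_nonsplit_contra ∧
      Kato2004.exists_multDivisibilityInputs_split_contra ∧ Kato2004.exists_multDivisibilityInputs_fine_contra ∧
      mazur_not_dvd_maninConstant_of_odd) :
    Theses.PrintX11a.UpperNonSurjFive :=
  upperNonSurjFive_of_muAnHardFive_of_nineFactsOddGS_glue₂ hH (nineFactsOddGS_of_nineFactsAn hI)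

/-- **U5 from item 19948 + BDMTV + g6's all-prime text, routed through the odd-keyed glue** (same statement shape as p627441's
`upperNonSurjFive_of_nonSurjCornerTwinMuAn_of_nineFacts_glue` with the conjunction grouped as one hypothesis).
[cite: BalakrishnanEtAl2019, §1 Thm. 1.2 (arXiv:1711.05846 p. 2)] [cite: Kobayashi2006DocMath, Cor. 4.2 (p. 575)] -/
theorem upperNonSurjFive_of_nonSurjCornerTwinMuAn_of_nineFactsAn_via_oddGS (hAn : NonSurjCornerTwinMuAn)
    (hB : thm12_not_le_normalizer_splitCartan)
    (hI : thm61_splitMultiplicative ∧ thm61_nonsplitMultiplicative ∧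
      (∀ (W : WeierstrassCurve ℚ) [W.IsElliptic] [W.IsGloballyMinimal] (p : ℕ) [Fact p.Prime],
        greenberg_stevens (W := W) (p := p)) ∧
      Kato2004.thm12_4 ∧ exists_isNewformOf ∧ Kato2004.exists_multDivisibilityInputs_nonsplit_contra ∧
      Kato2004.exists_multDivisibilityInputs_split_contra ∧ Kato2004.exists_multDivisibilityInputs_fine_contra ∧
      mazur_not_dvd_maninConstant_of_odd) :
    Theses.PrintX11a.UpperNonSurjFive :=
  upperNonSurjFive_of_nonSurjCornerTwinMuAn_of_nineFactsOddGS_glue₃ hAn hB (nineFactsOddGS_of_nineFactsAn hI)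

end Summit.BirchSwinnertonDyer.BirchSwinnertonDyer.Theorems

end
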